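import Summits.KontsevichZagierPeriods.Zeta5Search.RVFlatGaugeZoneCRows
import Summits.KontsevichZagierPeriods.Zeta5Search.PairCancellationProof
import HarnessLib.Audit
import HarnessLib

/-!
# RVZoneCVPairCover — the fifth constant-term certificate: COUNTING WITH CONJUGATE PAIRS; (VΓ) certified on ALL of zone C at `p = 5, 7`
(fam-rv gen 12, file 4; request #12.4)

HONEST FRAMING: systematic search; no irrationality claim unless certified.  Cell `pub-zeta5`, family `rv`, generation 12.
`p`-adic valuations of rational numbers attached to Brown–Zudilin's auxiliary series; nothing here concerns irrationality.

File 12.3 (`RVFlatGaugeZoneCRows`) reduced the two-long-block class law on zone C to the multipole-row law (R1) plus the constant-term floor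
(VΓ) `v_p V(c) ≥ −N_p(b) + zcBonus` (`c ∈ {b, b + e_j}`), and certified (VΓ) instance-wise by gen 9's four decidable tests `provedCaseZ`
(counting ‖ palindromic ‖ U-layer ‖ zero-layer) through `vBonusGuard` — on 2,701 of the 2,704 zone-C instances at `p = 5` and 22,061 of the
22,098 at `p = 7`.  The 3 + 37 instances left over all have the same anatomy (`gen12/HANDOFF.md` (29d); exact partial fractions): the classes
whose termwise floor `ν_x` lies below the target `t = −N_p + zcBonus = −1` are TWO-POINT classes `{q₀, q₀ + p}` of shape `(−1,−1)`
(`q₀ < p ≤ q₀ + p ≤ b₀ < q₀ + 2p`, simple poles at both points, `E_x = −2`), and they come in CONJUGATE PAIRS `x = q₀`, `x̄ = b₀ − q₀ − p`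
(a self-conjugate class counting alone); every other pole class has `ν_x ≥ t`.  For such a pair the typer's Lemma V4 digits (tree,
`ClusterValuation.classV_11` / `classV_11bar`, PROVED: `p²·V_x ≡ −g`, `p²·V_x̄ ≡ +g (mod p)`, `g = gTop₀`) give `v_p(V_x + V_x̄) ≥ −1`: the
leading digits cancel ACROSS the pair (not inside a class — inside, `v_p V_x = −2`).

This file adds that mechanism as a FIFTH decidable certificate and proves it sound:

* `twoPoint11 c p q`, `pairClass c p q` (Bool) — the shape test at `q` and at its conjugate `b₀ − q − p`;
* `pairCountingCase c p t` (Bool) — `t ≤ −1` and every pole class has `ν_x ≥ t` OR is a pair class;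
* `val_ge_of_pairCounting` (PROVED) — `pairCountingCase c p t → V(c) ≠ 0 → t ≤ v_p V(c)`: split `V = Σ_x V_x` (`coeffV_eq_sum_classV`) into
  the pair classes `P` and the rest; the rest is termwise (`padicNorm_classV_le`); on `P` the conjugation `x ↦ b₀ − x − p` is an involution
  of `P`, so `2·Σ_{x∈P} V_x = Σ_{x∈P} (V_x + V_x̄)` (`Finset.sum_nbij'`), each bracket has `‖p²(V_x + V_x̄)‖ ≤ p⁻¹` by `classV_11` +
  `classV_11bar` (ultrametric), i.e. `‖V_x + V_x̄‖ ≤ p ≤ p^{−t}`, and `‖2‖_p = 1`;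
* `provedCaseZ5 := provedCaseZ ‖ pairCountingCase`, `val_ge_of_provedCaseZ5` (PROVED); `vBonusGuard5`, `constantTermBonus_of_guard5`,
  `zoneCConstantTermBonus_of_guard5` (PROVED) — the analogues of file 12.3's guard lemmas with the fifth certificate;
* kernel instances: the guard fires on `b = (12; 6,6,6,6,5,3,2)`, `p = 5`, `j = 5, 6, 7` — the three zone-C instances at `p = 5` that
  `vBonusGuard` missed (`vBonusGuard5_examples`, `decide`).

EXACT CENSUS (`pub-zeta5-fam-rv/gen12/paircount.py`; partial fractions by the typer's `code/typer/pfdata.py`, exact `fractions`): with the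
fifth certificate the guard fires on 2,704 / 2,704 zone-C instances at `p = 5` and 22,098 / 22,098 at `p = 7` — (VΓ) is CERTIFIED FROM THE
TREE ON ALL OF ZONE C at `p = 5` and `p = 7` (instance-wise; the node `ZoneCConstantTermBonus` quantifies over all `p` and stays a node).
Soundness was also checked numerically before the proof was written: on the 34 (`p = 5`) + 246 (`p = 7`) pairs `(c, t)` where
`pairCountingCase` fires and `countingCase` does not, `v_p V(c) ≥ t` exactly, 0 exceptions (`out/paircount_p5_7.log`).  NET EFFECT for the
zone-C programme: at `p = 5, 7` the flat `S₇`-gauge law on zone C rests on the multipole-row law (R1) ALONE.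
Local compute ≈ 3 core-min.
-/

noncomputable section

namespace Summit.KontsevichZagierPeriods.Zeta5Search.RVFlatGauge

open Finset
open Summit.KontsevichZagierPeriods.Zeta5Search.CasoratianValuation (shift InPolytope pairFloors)
open Summit.KontsevichZagierPeriods.Zeta5Search.WedgeDictionary (coeffV)
open Summit.KontsevichZagierPeriods.Zeta5Search.ClusterValuation
open Summit.KontsevichZagierPeriods.Zeta5Search.PadicSeries
open Summit.KontsevichZagierPeriods.Zeta5Search.CellA (gTop)
open Cap ZoneC

/-! ### The shape tests -/

/-- Type-`(1,1)` two-point test at `q`: `q < p ≤ q + p ≤ b₀ < q + 2p` and simple poles (`netExp = −1`) at `q` and `q + p`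
(then the class of `q` is exactly `{q, q + p}`, `classSet_twoPoint`). -/
def twoPoint11 (c : ℕ → ℤ) (p q : ℕ) : Bool :=
  decide (q < p) && decide (q + p ≤ (c 0).toNat) && decide ((c 0).toNat < q + 2 * p) &&
    decide (netExp c q = -1) && decide (netExp c (q + p) = -1)

/-- PAIR-CLASS test at `q`: `q` and its conjugate `q̄ = b₀ − q − p` are both of type `(1,1)` (a self-conjugate `q = q̄` is allowed). -/
def pairClass (c : ℕ → ℤ) (p q : ℕ) : Bool :=
  twoPoint11 c p q && twoPoint11 c p ((c 0).toNat - (q + p))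

/-- COUNTING-WITH-PAIRS test at level `t`: `t ≤ −1`, and every pole class has `ν_x ≥ t` or is a pair class. -/
def pairCountingCase (c : ℕ → ℤ) (p : ℕ) (t : ℤ) : Bool :=
  decide (t ≤ -1) && decide (∀ x ∈ range p, 1 ≤ classPoleCount c p x → t ≤ classNu c p x ∨ pairClass c p x = true)

/-- Unfolding of the Boolean test `twoPoint11`: the class `{q, q+p}` is a type-`(1,1)` two-point class. -/
theorem twoPoint11_spec {c : ℕ → ℤ} {p q : ℕ} (h : twoPoint11 c p q = true) :
    q < p ∧ q + p ≤ (c 0).toNat ∧ (c 0).toNat < q + 2 * p ∧ netExp c q = -1 ∧ netExp c (q + p) = -1 := by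
  simp only [twoPoint11, Bool.and_eq_true, decide_eq_true_eq] at h
  obtain ⟨⟨⟨⟨h1, h2⟩, h3⟩, h4⟩, h5⟩ := h
  exact ⟨h1, h2, h3, h4, h5⟩

/-- Unfolding of the Boolean test `pairClass`: both the class of `q` and its conjugate are of type `(1,1)`. -/
theorem pairClass_iff {c : ℕ → ℤ} {p q : ℕ} :
    pairClass c p q = true ↔ twoPoint11 c p q = true ∧ twoPoint11 c p ((c 0).toNat - (q + p)) = true := by
  simp only [pairClass, Bool.and_eq_true]

/-! ### Soundness -/

section Sound

variable {p : ℕ} [hp : Fact p.Prime]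

/-- **The pair bracket** (PROVED, from the typer's `classV_11` / `classV_11bar`): for a type-`(1,1)` class `x = q` with conjugate `x̄ = b₀ − q − p`,
`‖V_x + V_x̄‖_p ≤ p` (i.e. `v_p ≥ −1 = E_x + 1`; each of `V_x`, `V_x̄` alone has `v_p = −2` in general). -/
theorem padicNorm_pairBracket_le (c : ℕ → ℤ) (hc : InPolytope c) (hp5 : 5 ≤ p) (hwin : (c 0 + 2 : ℤ) < (p : ℤ) ^ 2) {q : ℕ}
    (h : twoPoint11 c p q = true) :
    padicNorm p (classV c p q + classV c p ((c 0).toNat - (q + p))) ≤ (p : ℚ) ^ (1 : ℤ) := by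
  obtain ⟨hq0, hq1, hqt, he0, he1⟩ := twoPoint11_spec h
  have hA := classV_11 c hc hp5 hwin hq0 hq1 hqt he0 he1
  have hA' := classV_11bar c hc hp5 hwin hq0 hq1 hqt he0 he1
  have hsum : padicNorm p ((p : ℚ) ^ 2 * (classV c p q + classV c p ((c 0).toNat - (q + p)))) ≤ (p : ℚ) ^ (-(1 : ℤ)) := by
    have e : (p : ℚ) ^ 2 * (classV c p q + classV c p ((c 0).toNat - (q + p))) =
        ((p : ℚ) ^ 2 * classV c p q + gTop c p q 0) + ((p : ℚ) ^ 2 * classV c p ((c 0).toNat - (q + p)) - gTop c p q 0) := by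
      ring
    rw [e]
    exact (padicNorm.nonarchimedean).trans (max_le hA hA')
  have hv : classV c p q + classV c p ((c 0).toNat - (q + p)) ≠ 0 →
      -(1 : ℤ) ≤ padicValRat p (classV c p q + classV c p ((c 0).toNat - (q + p))) := fun hne => by
    have := le_padicValRat_of_pow_mul hne 2 hsum
    push_cast at this
    linarith
  have := padicNorm_le_of_val hv
  rwa [neg_neg] at this

/-- **COUNTING WITH PAIRS (PROVED):** `v_p V(c) ≥ t` when `t ≤ −1` and every pole class has `ν_x ≥ t` or is a pair class. -/
theorem val_ge_of_pairCounting (c : ℕ → ℤ) (hc : InPolytope c) (hp5 : 5 ≤ p) (hwin : (c 0 + 2 : ℤ) < (p : ℤ) ^ 2) {t : ℤ}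
    (h : pairCountingCase c p t = true) (hV : coeffV c ≠ 0) : t ≤ padicValRat p (coeffV c) := by
  simp only [pairCountingCase, Bool.and_eq_true, decide_eq_true_eq] at h
  obtain ⟨ht, hcl⟩ := h
  have hp1 : (1 : ℚ) ≤ p := by exact_mod_cast hp.out.one_lt.le
  have hodd : ¬ p ∣ 2 := fun h2 => by have := Nat.le_of_dvd (by norm_num) h2; omega
  have h2 : padicNorm p (2 : ℚ) = 1 := by exact_mod_cast (padicNorm.nat_eq_one_iff (p := p) 2).2 hodd
  set B : ℚ := (p : ℚ) ^ (-t) with hB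
  have hB0 : 0 ≤ B := zpow_p_nonneg _
  have hpB : (p : ℚ) ^ (1 : ℤ) ≤ B := zpow_le_zpow_right₀ hp1 (by omega)
  set P : Finset ℕ := (range p).filter (fun x => pairClass c p x = true) with hP
  -- conjugation is an involution of `P`
  have hconj : ∀ x ∈ P, (c 0).toNat - (x + p) ∈ P ∧ (c 0).toNat - (((c 0).toNat - (x + p)) + p) = x := by
    intro x hx
    rw [hP, mem_filter] at hx
    obtain ⟨h1, h1'⟩ := pairClass_iff.1 hx.2
    obtain ⟨hq0, hq1, hqt, -, -⟩ := twoPoint11_spec h1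
    obtain ⟨hr0, -, -, -, -⟩ := twoPoint11_spec h1'
    have hback : (c 0).toNat - (((c 0).toNat - (x + p)) + p) = x := by omega
    refine ⟨?_, hback⟩
    rw [hP, mem_filter]
    exact ⟨mem_range.2 hr0, pairClass_iff.2 ⟨h1', by rw [hback]; exact h1⟩⟩
  have hre : ∑ x ∈ P, classV c p ((c 0).toNat - (x + p)) = ∑ x ∈ P, classV c p x :=
    sum_nbij' (fun x => (c 0).toNat - (x + p)) (fun x => (c 0).toNat - (x + p)) (fun x hx => (hconj x hx).1)
      (fun x hx => (hconj x hx).1) (fun x hx => (hconj x hx).2) (fun x hx => (hconj x hx).2) (fun x hx => rfl)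
  -- the pair classes
  have hSP : padicNorm p (∑ x ∈ P, classV c p x) ≤ B := by
    have e : (2 : ℚ) * ∑ x ∈ P, classV c p x = ∑ x ∈ P, (classV c p x + classV c p ((c 0).toNat - (x + p))) := by
      rw [sum_add_distrib, hre, two_mul]
    have h : padicNorm p (∑ x ∈ P, (classV c p x + classV c p ((c 0).toNat - (x + p)))) ≤ B := by
      refine padicNorm.sum_le' (fun x hx => ?_) hB0
      rw [hP, mem_filter] at hx
      exact (padicNorm_pairBracket_le c hc hp5 hwin (pairClass_iff.1 hx.2).1).trans hpB
    rw [← e, padicNorm.mul, h2, one_mul] at h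
    exact h
  -- the other classes, termwise
  have hrest : padicNorm p (∑ x ∈ (range p).filter (fun x => ¬ pairClass c p x = true), classV c p x) ≤ B := by
    refine padicNorm.sum_le' (fun x hx => ?_) hB0
    rw [mem_filter, mem_range] at hx
    rcases Nat.eq_zero_or_pos (classPoleCount c p x) with h0 | hpos
    · rw [classV_eq_zero_of_noPole c hc h0, padicNorm.zero]; exact hB0
    · have hν := (hcl x (mem_range.2 hx.1) hpos).resolve_right hx.2
      exact (padicNorm_classV_le c hc hp5 hwin hx.1 hpos).trans (zpow_le_zpow_right₀ hp1 (by linarith))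
  refine val_ge_of_padicNorm_le hV ?_
  rw [coeffV_eq_sum_classV c hp.out.pos, ← sum_filter_add_sum_filter_not (range p) (fun x => pairClass c p x = true)]
  exact (padicNorm.nonarchimedean).trans (max_le hSP hrest)

/-! ### The five-way certificate and the guard -/

/-- Gen 9's four certificates OR counting-with-pairs. -/
def provedCaseZ5 (c : ℕ → ℤ) (p : ℕ) (t : ℤ) : Bool :=
  provedCaseZ c p t || pairCountingCase c p t

omit hp in
/-- **Soundness of `provedCaseZ5`** (PROVED). -/
theorem val_ge_of_provedCaseZ5 [Fact p.Prime] (c : ℕ → ℤ) (hc : InPolytope c) (hp5 : 5 ≤ p) (hwin : (c 0 + 2 : ℤ) < (p : ℤ) ^ 2)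
    {t : ℤ} (h : provedCaseZ5 c p t = true) (hV : coeffV c ≠ 0) : t ≤ padicValRat p (coeffV c) := by
  simp only [provedCaseZ5, Bool.or_eq_true] at h
  rcases h with h | h
  · exact val_ge_of_provedCaseZ c hc hp5 hwin h hV
  · exact val_ge_of_pairCounting c hc hp5 hwin h hV

end Sound

/-- DECIDABLE GUARD for (VΓ) at an instance with the fifth certificate: `δ ≤ 0` (then (VΓ) is THEOREM V) or `provedCaseZ5` fires for both
`b` and `b + e_j` at `t = −N_p(b) + δ`. -/
def vBonusGuard5 (b : ℕ → ℤ) (j p : ℕ) (δ : ℤ) : Bool :=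
  decide (δ ≤ 0) || (provedCaseZ5 b p (-pairFloors b p + δ) && provedCaseZ5 (shift b j) p (-pairFloors b p + δ))

/-- `vBonusGuard5` extends file 12.3's `vBonusGuard`. -/
theorem vBonusGuard5_of_vBonusGuard {b : ℕ → ℤ} {j p : ℕ} {δ : ℤ} (h : vBonusGuard b j p δ = true) : vBonusGuard5 b j p δ = true := by
  simp only [vBonusGuard, vBonusGuard5, provedCaseZ5, Bool.or_eq_true, Bool.and_eq_true] at h ⊢
  rcases h with h | ⟨h1, h2⟩
  · exact Or.inl h
  · exact Or.inr ⟨Or.inl h1, Or.inl h2⟩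

/-- **Soundness of `vBonusGuard5`** (PROVED): the constant terms of `b` and `b + e_j` have `v_p ≥ −N_p(b) + δ`. -/
theorem constantTermBonus_of_guard5 (b : ℕ → ℤ) {j p : ℕ} (hb : InPolytope b) (hj1 : 1 ≤ j) (hb' : InPolytope (shift b j))
    (hprime : p.Prime) (hp5 : 5 ≤ p) (hwin : (b 0 + 2 : ℤ) < (p : ℤ) ^ 2) {δ : ℤ} (hg : vBonusGuard5 b j p δ = true) :
    (coeffV b ≠ 0 → -pairFloors b p + δ ≤ padicValRat p (coeffV b)) ∧
      (coeffV (shift b j) ≠ 0 → -pairFloors b p + δ ≤ padicValRat p (coeffV (shift b j))) := by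
  haveI : Fact p.Prime := ⟨hprime⟩
  have hp1 : (1 : ℚ) < p := by exact_mod_cast hprime.one_lt
  have hwin' : (shift b j 0 + 2 : ℤ) < (p : ℤ) ^ 2 := by rwa [BigPrime.shift_zero b hj1]
  simp only [vBonusGuard5, Bool.or_eq_true, Bool.and_eq_true, decide_eq_true_eq] at hg
  rcases hg with hδ | ⟨hz, hz'⟩
  · refine ⟨fun hne => val_ge_of_padicNorm_le hne ?_, fun hne => val_ge_of_padicNorm_le hne ?_⟩
    · exact (padicNorm_coeffV_le_pairFloors b hb hp5 hwin).trans (zpow_le_zpow_right₀ hp1.le (by omega))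
    · have hN' : pairFloors (shift b j) p ≤ pairFloors b p := pairFloors_shift_le b hj1 p hprime.pos
      exact (padicNorm_coeffV_le_pairFloors (shift b j) hb' hp5 hwin').trans (zpow_le_zpow_right₀ hp1.le (by omega))
  · exact ⟨fun hne => val_ge_of_provedCaseZ5 b hb hp5 hwin hz hne, fun hne => val_ge_of_provedCaseZ5 (shift b j) hb' hp5 hwin' hz' hne⟩

/-- (VΓ) at every zone-C instance where the five-way guard fires at `δ = zcBonus` (PROVED) — by `paircount.py` that is EVERY zone-C instance
at `p = 5` (2,704) and `p = 7` (22,098). -/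
theorem zoneCConstantTermBonus_of_guard5 (b : ℕ → ℤ) {j p i₁ i₂ : ℕ} (hb : InPolytope b) (hj1 : 1 ≤ j)
    (hb' : InPolytope (shift b j)) (hprime : p.Prime) (hp5 : 5 ≤ p) (hb3 : b 0 < 3 * (p : ℤ))
    (hg : vBonusGuard5 b j p (zcBonus b p i₁ i₂) = true) :
    (coeffV b ≠ 0 → -pairFloors b p + zcBonus b p i₁ i₂ ≤ padicValRat p (coeffV b)) ∧
      (coeffV (shift b j) ≠ 0 → -pairFloors b p + zcBonus b p i₁ i₂ ≤ padicValRat p (coeffV (shift b j))) :=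
  constantTermBonus_of_guard5 b hb hj1 hb' hprime hp5 (win_of_lt_three_p hp5 hb3) hg

/-! ### Kernel instances: the three zone-C instances at `p = 5` missed by `vBonusGuard` -/

/-- `b = (12; 6,6,6,6,5,3,2)` at `p = 5` (long slots `6, 7`, `N_5 = 2`, `Γ = 1`, target `t = −1`): the classes `{3, 8}` and `{4, 9}` are a
conjugate pair of type `(1,1)` with `v_5 V_x = −2` each and `v_5(V_3 + V_4) = −1`. -/
def bR3 : ℕ → ℤ := fun i => (([12, 6, 6, 6, 6, 5, 3, 2] : List ℤ).getD i 0)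

/-- The fifth certificate fires where the four of gen 9 do not (`j = 5, 6, 7`), and `vBonusGuard` indeed fails there. -/
theorem vBonusGuard5_examples :
    vBonusGuard5 bR3 5 5 1 = true ∧ vBonusGuard5 bR3 6 5 1 = true ∧ vBonusGuard5 bR3 7 5 1 = true ∧ vBonusGuard bR3 5 5 1 = false := by
  refine ⟨?_, ?_, ?_, ?_⟩ <;> decide

end Summit.KontsevichZagierPeriods.Zeta5Search.RVFlatGauge

end
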